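import Summits.AtomisticToContinuum.Crystallization.Theorems.ExcessDecayLiouvilleNonlinearCaccioppoli
import Summits.AtomisticToContinuum.Crystallization.Theorems.ExcessDecayLiouvilleFluxPairingSq

/-!
# Route `ExcessDecayLiouville`: the nonlinear Caccioppoli inequality for one pair of radii (nonlinear Caccioppoli, II)

Harmonic-replacement architecture for item `ExcessDecay` (stmt-AtomisticToContinuum-9334), nonlinear half.
For a finitely supported field `f` whose rows on the sites of `SR ∩ B_R(c₀)` are a forcing plus an
antisymmetric flux dominated by `Λ (dist)⁻⁸ ‖vt p − vt q‖`, and a Lipschitz cut-off `η` (scale `d ≥ 1`)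
supported in `B_R(c₀)`, harmonic stability gives (`nonlinear_caccioppoli_pair`)

`nnForm(η f) ≤ (2/κ)(forcing work + far flux + cut-off junk) + (2 (4·10⁶Λ)²/κ²) NN[vt, R + 10L + 20]
  + ((11/10)⁸/d²) C₆ 𝐌[f, R]`:

the near flux is absorbed (`ab ≤ κb²/4 + a²/κ`), leaving the gradient mass of `vt` on a LARGER ball with
the small factor `2(4·10⁶Λ)²/κ²` — the input of Giaquinta's iteration.
All `[folklore]`; helper lemmas, nothing here closes an item.
-/

noncomputable section

namespace Summit.AtomisticToContinuum.Crystallization.Theorems.ExcessDecayLiouville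

open scoped BigOperators Topology InnerProductSpace RealInnerProductSpace Classical
open Literature.MathematicalPhysics.StatisticalMechanics
open Summit.AtomisticToContinuum.Crystallization.Theorems.PhononStabilityNegative

-- Local notation: the force-constant map `K(e)w = h(|e|²)w + 2⟪e,w⟫h′(|e|²)e`.
local notation3 "𝕂[" e "] " w:max =>
  (-((‖e‖ ^ 2)⁻¹) ^ 7 + ((‖e‖ ^ 2)⁻¹) ^ 4) • w + (2 * ⟪e, w⟫ * (7 * ((‖e‖ ^ 2)⁻¹) ^ 8 - 4 * ((‖e‖ ^ 2)⁻¹) ^ 5)) • e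
set_option quotPrecheck false in
-- Local notation: ball indicator.
local notation "𝟙ᵇ[" x ", " c ", " R "]" => (if dist (x : EuclideanSpace ℝ (Fin 3)) c ≤ R then (1 : ℝ) else 0)
set_option quotPrecheck false in
-- Local notation: far kernel.
local notation "𝔣[" ρ ", " p ", " q "]" =>
  (if ρ < dist (p : EuclideanSpace ℝ (Fin 3)) q then (dist (p : EuclideanSpace ℝ (Fin 3)) q)⁻¹ ^ 8 else (0 : ℝ))

section

variable {t : Fin 2 → (EuclideanSpace ℝ (Fin 3))} {A : (EuclideanSpace ℝ (Fin 3)) →L[ℝ] (EuclideanSpace ℝ (Fin 3))}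
  {κ : ℝ}

variable (hA : Adm₀ A) (hI : Inner₀ t A)

set_option quotPrecheck false in
-- Local notation: the operator row `(L v)(p)`.
local notation "𝕃" v:max " @ " p:max =>
  tsum (fun q : Sites₀ t A => (if ((p : Sites₀ t A) : EuclideanSpace ℝ (Fin 3)) ≠ q then
    𝕂[((p : Sites₀ t A) : EuclideanSpace ℝ (Fin 3)) - q] (v ((p : Sites₀ t A) : EuclideanSpace ℝ (Fin 3)) - v q) else 0))
set_option quotPrecheck false in
-- Local notation: the finite near-neighbour form on the ball of radius `X` about `c`.
local notation "NN[" v ", " c ", " X "]" =>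
  (∑ p ∈ (finite_sites_dist_le (t := t) (A := A) hA hI c X).toFinset,
    ∑ q ∈ (finite_sites_dist_le (t := t) (A := A) hA hI c X).toFinset,
      (if p ≠ q ∧ dist p q ≤ 11 / 10 then ‖v p - v q‖ ^ 2 else (0 : ℝ)))

omit hA hI in
/-- The scalar absorption step behind `nonlinear_caccioppoli_pair`: from `κX ≤ W + J`, `W ≤ P + Sf/2`,
`Sf ≤ 2Λ(4·10⁶ √N √Y + F)`, `Y ≤ 2X + 2cM` conclude `X ≤ (2/κ)(P + ΛF + J) + 2(4·10⁶Λ)²N/κ² + cM`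
(`ab ≤ κb²/4 + a²/κ`). [folklore] -/
theorem caccioppoli_absorb {κ X Y N P Sf F J M W Λ c : ℝ} (hκ0 : 0 < κ) (hY0 : 0 ≤ Y) (hN0 : 0 ≤ N)
    (hcac : κ * X ≤ W + J) (hwork : W ≤ P + 1 / 2 * Sf)
    (hflux : Sf ≤ 2 * Λ * (4000000 * Real.sqrt N * Real.sqrt Y + F)) (hsq : Y ≤ 2 * X + 2 * c * M) :
    X ≤ 2 / κ * (P + Λ * F + J) + 2 * (4000000 * Λ) ^ 2 / κ ^ 2 * N + c * M := by
  have hκX : κ * X ≤ P + 1 / 2 * Sf + J := by linarith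
  have hSf' : 1 / 2 * Sf ≤ Λ * (4000000 * Real.sqrt N * Real.sqrt Y) + Λ * F := by linarith [hflux]
  have hag : (4000000 * Λ) * Real.sqrt N * Real.sqrt Y ≤ κ / 4 * Y + (4000000 * Λ) ^ 2 * N / κ := by
    have h1 := sq_nonneg (κ / 2 * Real.sqrt Y - (4000000 * Λ) * Real.sqrt N)
    have hYs := Real.sq_sqrt hY0
    have hNs := Real.sq_sqrt hN0
    rw [show κ / 4 * Y + (4000000 * Λ) ^ 2 * N / κ = (κ ^ 2 / 4 * Y + (4000000 * Λ) ^ 2 * N) / κ by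
      field_simp; try ring]
    rw [le_div_iff₀ hκ0]
    nlinarith [h1, hYs, hNs, Real.sqrt_nonneg Y, Real.sqrt_nonneg N]
  have hmain : κ * X ≤ P + (κ / 4 * (2 * X + 2 * c * M) + (4000000 * Λ) ^ 2 * N / κ) + Λ * F + J := by
    have h2 : Λ * (4000000 * Real.sqrt N * Real.sqrt Y) = (4000000 * Λ) * Real.sqrt N * Real.sqrt Y := by ring
    have h3 : κ / 4 * Y ≤ κ / 4 * (2 * X + 2 * c * M) := mul_le_mul_of_nonneg_left hsq (by linarith)
    linarith [hκX, hSf', hag, h2, h3]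
  have hsolve : κ / 2 * X ≤ P + Λ * F + J + (4000000 * Λ) ^ 2 * N / κ + κ / 2 * (c * M) := by linarith [hmain]
  have h := mul_le_mul_of_nonneg_left hsolve (by positivity : (0 : ℝ) ≤ 2 / κ)
  have e1 : 2 / κ * (κ / 2 * X) = X := by field_simp
  have e2 : 2 / κ * (P + Λ * F + J + (4000000 * Λ) ^ 2 * N / κ + κ / 2 * (c * M)) =
      2 / κ * (P + Λ * F + J) + 2 * (4000000 * Λ) ^ 2 / κ ^ 2 * N + c * M := by
    field_simp; try ring
  rw [e1, e2] at h
  exact h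

include hA hI in
/-- **The nonlinear Caccioppoli inequality for one pair of radii** (see the module docstring). [folklore] -/
theorem nonlinear_caccioppoli_pair (hκ0 : 0 < κ)
    (hκ : ∀ v : (EuclideanSpace ℝ (Fin 3)) → (EuclideanSpace ℝ (Fin 3)), (Function.support v).Finite →
      Function.support v ⊆ Sites₀ t A → κ * nnForm t A v ≤ ∑' p : Sites₀ t A, ⟪𝕃 v @ p, v p⟫)
    {f : (EuclideanSpace ℝ (Fin 3)) → (EuclideanSpace ℝ (Fin 3))} (hf : (Function.support f).Finite)
    {Bf : ℝ} (hfB : ∀ x, ‖f x‖ ≤ Bf)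
    {η : (EuclideanSpace ℝ (Fin 3)) → ℝ} (hη : (Function.support η).Finite) (hηS : Function.support η ⊆ Sites₀ t A)
    (hη0 : ∀ x, 0 ≤ η x) (hη1 : ∀ x, η x ≤ 1) {c₀ : EuclideanSpace ℝ (Fin 3)} {R d : ℝ} (hd : 1 ≤ d)
    (hηR : ∀ x, R < dist x c₀ → η x = 0)
    (hlip : ∀ p q : Sites₀ t A, |η p - η q| ≤ ‖(p : (EuclideanSpace ℝ (Fin 3))) - q‖ / d)
    (SR : Finset (EuclideanSpace ℝ (Fin 3))) (hSRS : ∀ x ∈ SR, x ∈ Sites₀ t A)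
    (hSRball : ∀ x ∈ Sites₀ t A, dist x c₀ ≤ R → x ∈ SR)
    (φ : (EuclideanSpace ℝ (Fin 3)) → (EuclideanSpace ℝ (Fin 3)))
    (Φ : (EuclideanSpace ℝ (Fin 3)) → (EuclideanSpace ℝ (Fin 3)) → (EuclideanSpace ℝ (Fin 3)))
    (hrow : ∀ p : Sites₀ t A, (p : EuclideanSpace ℝ (Fin 3)) ∈ SR → dist (p : EuclideanSpace ℝ (Fin 3)) c₀ ≤ R →
      𝕃 f @ p = φ p + ∑ q ∈ SR.erase p, Φ p q)
    (hanti : ∀ p ∈ SR, ∀ q ∈ SR, Φ q p = -Φ p q)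
    {vt : (EuclideanSpace ℝ (Fin 3)) → (EuclideanSpace ℝ (Fin 3))} {Λ Θ₂ L : ℝ} (hΛ : 0 ≤ Λ) (hL : 1 ≤ L)
    (hΦ : ∀ p ∈ SR, ∀ q ∈ SR, p ≠ q → ‖Φ p q‖ ≤ Λ * (dist p q)⁻¹ ^ 8 * ‖vt p - vt q‖)
    (hΘ : ∑ p ∈ SR.filter (fun p => dist p c₀ ≤ R),
      ∑ q ∈ (SR.erase p).filter (fun q => ¬ dist p q ≤ L), (dist p q)⁻¹ ^ 8 * ‖vt q‖ ^ 2 ≤ Θ₂) :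
    nnForm t A (fun x => η x • f x) ≤
      2 / κ * ((∑ p ∈ SR, (η p) ^ 2 * (‖φ p‖ * ‖f p‖)) +
          Λ * ((3 * (1024 / ((23 / 25 : ℝ) ^ 3 * L ^ 5)) * Real.sqrt (∑ x ∈ SR.filter (fun p => dist p c₀ ≤ R), ‖vt x‖ ^ 2) +
            Real.sqrt (1024 / ((23 / 25 : ℝ) ^ 3 * L ^ 5)) * Real.sqrt Θ₂) *
              Real.sqrt (∑ x ∈ SR, ‖(η x) ^ 2 • f x‖ ^ 2)) +
          (19 * (1024 / ((23 / 25 : ℝ) ^ 3 * (23 / 25 : ℝ) ^ 3)) / d ^ 2 * (∑' p : Sites₀ t A, ‖f p‖ ^ 2 * 𝟙ᵇ[p, c₀, R + d]) +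
            19 * 1 * (1024 / ((23 / 25 : ℝ) ^ 3 * d ^ 5)) * (∑' p : Sites₀ t A, ‖f p‖ ^ 2 * 𝟙ᵇ[p, c₀, R]) +
            19 * (1 : ℝ)⁻¹ * (∑' p : Sites₀ t A, ∑' q : Sites₀ t A, (if (p : (EuclideanSpace ℝ (Fin 3))) ≠ q then
              𝔣[d, p, q] * 𝟙ᵇ[p, c₀, R] * ‖f q‖ ^ 2 else 0)))) +
      2 * (4000000 * Λ) ^ 2 / κ ^ 2 * NN[vt, c₀, R + 10 * L + 20] +
      ((11 / 10 : ℝ) ^ 8 / d ^ 2) * ((1024 / ((23 / 25 : ℝ) ^ 3 * (23 / 25 : ℝ) ^ 3)) *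
        ∑' q : Sites₀ t A, ‖f q‖ ^ 2 * 𝟙ᵇ[q, c₀, R + 0]) := by
  have hd0 : 0 < d := by linarith
  have hηabs : ∀ x, |η x| ≤ 1 := fun x => abs_le.2 ⟨by linarith [hη0 x], hη1 x⟩
  -- where `η ≠ 0`
  have hηT : ∀ x, η x ≠ 0 → x ∈ SR ∧ dist x c₀ ≤ R := by
    intro x hx
    have hxS : x ∈ Sites₀ t A := hηS (Function.mem_support.2 hx)
    have hxR : dist x c₀ ≤ R := by by_contra h; exact hx (hηR x (lt_of_not_ge h))
    exact ⟨hSRball x hxS hxR, hxR⟩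
  -- the test field `W = η² f`
  have hW : (Function.support fun x => (η x) ^ 2 • f x).Finite :=
    hf.subset fun x hx => by
      rw [Function.mem_support] at hx ⊢; intro h; exact hx (by rw [h, smul_zero])
  have hWB : ∀ x, (fun x => (η x) ^ 2 • f x) x ≠ 0 → x ∈ SR ∧ dist x c₀ ≤ R := by
    intro x hx
    refine hηT x fun h => hx ?_
    simp only [h]; simp
  -- (1) the cut-off identity with the junk
  have hcac := caccioppoli_l2_tail_weighted hA hI hκ hf hfB hη hηS hη0 hη1 hd (by norm_num : (0 : ℝ) < 1)
    (R := R) (c := c₀) (fun p hp => hηR p hp) hlip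
  -- (2) the work of the flux rows
  have hwork := work_flux_le η SR hSRS hηT φ Φ hrow hanti (f := f)
  -- (3) the flux pairing
  have hflux := flux_pairing_le'' hA hI hW SR hSRS hWB Φ hanti hΛ hL hΦ hΘ (vt := vt)
  -- (4) the strain form of `W`
  have hsq := nnForm_sqCutoff_le hA hI hf hη0 hη1 hd0 (R := R) (c₀ := c₀) hηR hlip
  -- the scalar absorption
  have hY0 : 0 ≤ nnForm t A (fun x => (η x) ^ 2 • f x) := nnForm_nonneg t A _
  have hN0 : 0 ≤ NN[vt, c₀, R + 10 * L + 20] :=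
    Finset.sum_nonneg fun p _ => Finset.sum_nonneg fun q _ => by positivity
  exact caccioppoli_absorb hκ0 hY0 hN0 hcac hwork hflux hsq

end

end Summit.AtomisticToContinuum.Crystallization.Theorems.ExcessDecayLiouville

end
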